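import Summits.MatrixMultiplication.MatrixMultiplication.Theorems.SoloInformedTwistedMatchingsPrimeHost
import HarnessLib

/-!
# How fast `δ_P → 0` must go: matchings in `𝔽_P^k` of size `r₃(⌊P/2⌋)^k`

Solo-informed seat (MatrixMultiplication), gen 101; sharpest-statement §2y(8), clause (b).
Matchings multiply, so the one-dimensional matching of `threeAPFree_matching_zmod` gives untwisted
matchings in `𝔽_P^k = (ℤ/P)^k` of size `r₃(N)^k`, `N = ⌊P/2⌋` (`exists_matching_pi_zmod`).
Consequently (`rpow_le_of_pi_zmod_bound`) any exponent saving `δ` valid over ALL `𝔽_P^k`, `k ≥ 0` —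
`|ι| ≤ 3 (P^k)^{1-δ}` for every matching — satisfies
`⌊P/2⌋ · e^{-4√(log ⌊P/2⌋)} ≤ P^{1-δ}`, i.e. `δ ≤ (log(P/⌊P/2⌋) + 4√(log ⌊P/2⌋)) / log P = O(1/√log P)`:
Theorem B″'s `δ(P)` (which is `≍ 1/log P` in the seat's paper version, ineffective in the kernel)
cannot decay slower than `O(1/√(log P))`. The regime "characteristic `→ ∞`" of Cohn–Umans 2013 §5
therefore needs `|M₀| ≥ |S|^{δ(P) - o(1)}` only with a vanishing exponent — B″ says nothing uniform
there.
References: Behrend (1946); CohnUmans2013 (arXiv:1207.6528) §5; BCCGNSU17 (arXiv:1605.06702) §1, §4.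
-/

noncomputable section

open scoped BigOperators
open Finset

namespace Summit.MatrixMultiplication.MatrixMultiplication.Theorems.TwistedSliceRank

section ProductHost

/-- **Matchings multiply**: untwisted matchings in `(ℤ/P)^k` of size `r₃(N)^k` for `2N ≤ P`.
[folklore] -/
theorem exists_matching_pi_zmod (P : ℕ) [NeZero P] (N : ℕ) (hP : 2 * N ≤ P) (k : ℕ) :
    ∃ (ι : Type) (_ : Fintype ι) (x y z : ι → (Fin k → Multiplicative (ZMod P))),
      (∀ i j l : ι, (x i * y j * z l = 1) ↔ (i = j ∧ j = l)) ∧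
      Fintype.card ι = rothNumberNat N ^ k := by
  obtain ⟨t, htN, htcard, ht⟩ := rothNumberNat_spec N
  obtain ⟨x₀, y₀, z₀, h₀⟩ := threeAPFree_matching_zmod N ht htN P hP
  refine ⟨Fin k → ↥t, inferInstance, fun i a => x₀ (i a), fun i a => y₀ (i a), fun i a => z₀ (i a),
    fun i j l => ?_, ?_⟩
  · simp only [funext_iff, Pi.mul_apply, Pi.one_apply, h₀]
    exact ⟨fun h => ⟨fun a => (h a).1, fun a => (h a).2⟩, fun h a => ⟨h.1 a, h.2 a⟩⟩
  · rw [Fintype.card_fun, Fintype.card_coe, htcard, Fintype.card_fin]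

/-- **A uniform saving over all `𝔽_P^k` is at most `O(1/√log P)`.** If every untwisted matching in
every `(ℤ/P)^k` has `≤ 3 (P^k)^{1-δ}` elements, then `⌊P/2⌋ e^{-4√(log ⌊P/2⌋)} ≤ P^{1-δ}`
(matchings of size `r₃(⌊P/2⌋)^k`, Behrend, and `k → ∞`). [this work] -/
theorem rpow_le_of_pi_zmod_bound (P : ℕ) [NeZero P] (δ : ℝ)
    (hB : ∀ (k : ℕ) (ι : Type) [Fintype ι] (x y z : ι → (Fin k → Multiplicative (ZMod P))),
      (∀ i j l : ι, (x i * y j * z l = 1) ↔ (i = j ∧ j = l)) →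
      (Fintype.card ι : ℝ) ≤ 3 * ((P : ℝ) ^ k) ^ (1 - δ)) :
    ((P / 2 : ℕ) : ℝ) * Real.exp (-4 * Real.sqrt (Real.log ((P / 2 : ℕ) : ℝ))) ≤
      (P : ℝ) ^ (1 - δ) := by
  set N : ℕ := P / 2 with hN
  set a : ℝ := (N : ℝ) * Real.exp (-4 * Real.sqrt (Real.log (N : ℝ))) with ha
  set b : ℝ := (P : ℝ) ^ (1 - δ) with hb
  have hP0 : (0 : ℝ) < P := by exact_mod_cast Nat.pos_of_ne_zero (NeZero.ne P)
  have hb0 : 0 < b := Real.rpow_pos_of_pos hP0 _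
  have ha0 : 0 ≤ a := by rw [ha]; positivity
  have h2N : 2 * N ≤ P := by rw [hN]; omega
  -- `a^k ≤ 3 b^k` for every `k`
  have hk : ∀ k : ℕ, a ^ k ≤ 3 * b ^ k := by
    intro k
    obtain ⟨ι, _, x, y, z, hm, hcard⟩ := exists_matching_pi_zmod P N h2N k
    have h1 := hB k ι x y z hm
    rw [hcard] at h1
    push_cast at h1
    have hBeh : a ≤ (rothNumberNat N : ℝ) := Behrend.roth_lower_bound
    have h2 : ((P : ℝ) ^ k) ^ (1 - δ) = b ^ k := by
      rw [hb, ← Real.rpow_natCast, ← Real.rpow_mul hP0.le, mul_comm, Real.rpow_mul hP0.le,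
        Real.rpow_natCast]
    calc a ^ k ≤ (rothNumberNat N : ℝ) ^ k := pow_le_pow_left₀ ha0 hBeh k
      _ ≤ 3 * ((P : ℝ) ^ k) ^ (1 - δ) := h1
      _ = 3 * b ^ k := by rw [h2]
  -- hence `a ≤ b`
  by_contra hab
  rw [not_le] at hab
  set ε : ℝ := a / b - 1 with hε
  have hε0 : 0 < ε := by
    rw [hε, sub_pos, lt_div_iff₀ hb0, one_mul]; exact hab
  obtain ⟨k, hk2⟩ := exists_nat_gt (2 / ε)
  have h3 : (1 + ε) ^ k ≤ 3 := by
    have h4 : (1 + ε) = a / b := by rw [hε]; ring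
    rw [h4, div_pow, div_le_iff₀ (pow_pos hb0 k)]
    exact hk k
  have h5 : 1 + (k : ℝ) * ε ≤ (1 + ε) ^ k := one_add_mul_le_pow (by linarith) k
  have h6 : 2 < (k : ℝ) * ε := by
    rw [div_lt_iff₀ hε0] at hk2; linarith
  linarith

end ProductHost

end Summit.MatrixMultiplication.MatrixMultiplication.Theorems.TwistedSliceRank
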